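import Summits.BirchSwinnertonDyer.Rank1Residual.X11b.CastellaErratumCongruenceLimit
import HarnessLib

/-!
# Sanity instance for the congruence skeleton: its hypotheses are satisfiable with `M ≠ 0`
# (cell `b2b-bsdres`, X11b route R1)

HONEST FRAMING (cell `b2b-bsdres`, run/shared/lean/b2b/bsd-rank1-residual/, verbatim in every
file): the goal of the cell is to DELETE the COMBINATION-SHAPED residual classes of the
Birch–Swinnerton-Dyer formula for ALL analytic-rank `≤ 1` elliptic curves over `ℚ` — "full BSD
formula for every rank `≤ 1` curve in class `C`" assembled STRICTLY from published theorems — so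
that the rank-`≤ 1` remainder becomes exactly the CONSTRUCTION-SHAPED classes, which are TYPED
(missing-input `Prop`s), NOT attempted. This is not "finishing BSD". Sub-cell
`b2b-bsdres-multr1-p1`: a RESEARCH ROUTE; no claim beyond the stated class; X11b stays
CONSTRUCTION-SHAPED; nothing here changes a label. THEOREMS ONLY.

Why this file exists: generation 1 of this route landed end forms whose link hypotheses were
quantified over ALL `IsHeegnerPoint` points and turned out to be UNSATISFIABLE at every pair with a
non-torsion Heegner point (lit seat g14, `X11b/HeegnerPointScaling.lean`; repaired in generation 2).
To rule out the same defect for the kernel skeleton of erratum p. 4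
(`isTorsion_and_charIdeal_eq_of_congruences`, `CastellaErratumCongruenceLimit.lean`), this file
INSTANTIATES its hypotheses non-trivially: over any Noetherian UFD `R` with an ideal `I ⊆ Jac(R)`
and any `L ≠ 0`, the data `M = N_m = R/(L)`, `L_m = L`, `e =` identity satisfy `e`, `hF`, `hc`
(`congruenceSkeleton_hypotheses_hold_quotient`), and the skeleton then returns the (independently
proved) value `char(R/(L)) = (L)` (`congruenceSkeleton_conclusion_quotient`). So the hypothesis
SHAPE of the skeleton is consistent with `M ≠ 0` (`R/(L) ≠ 0` for a non-unit `L`); of course this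
says nothing about the arithmetic inputs themselves.
-/

noncomputable section

open Literature.RingTheory.FittingIdeal Literature.NumberTheory.EllipticCurves
  Literature.NumberTheory.EllipticCurves.Module

namespace Summit.BirchSwinnertonDyer.Rank1Residual.X11b.CongruenceLimit

universe u

variable {R : Type u} [CommRing R]

/-- **The skeleton's hypotheses hold for `M = N_m = R/(L)`, `L_m = L`** (any ring, any ideal `I`):
the quotient isomorphisms are identities, `Fitt₀(R/(L)) = (L)` (`fittingIdeal_zero_quotient`), and
the congruences `(L) + I^m = (L) + I^m` are trivial. [folklore] -/
theorem congruenceSkeleton_hypotheses_hold_quotient (I : Ideal R) (L : R) :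
    (∀ m : ℕ, 1 ≤ m → Nonempty
      (((R ⧸ Ideal.span {L}) ⧸ (I ^ m • (⊤ : Submodule R (R ⧸ Ideal.span {L})))) ≃ₗ[R]
        ((R ⧸ Ideal.span {L}) ⧸ (I ^ m • (⊤ : Submodule R (R ⧸ Ideal.span {L})))))) ∧
    (∀ m : ℕ, 1 ≤ m → Module.fittingIdeal R (R ⧸ Ideal.span {L}) 0 = Ideal.span {L}) ∧
    (∀ m : ℕ, 1 ≤ m → Ideal.span {L} ⊔ I ^ m = Ideal.span {L} ⊔ I ^ m) :=
  ⟨fun _ _ => ⟨LinearEquiv.refl R _⟩, fun _ _ => fittingIdeal_zero_quotient (Ideal.span {L}),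
    fun _ _ => rfl⟩

/-- **The skeleton applied to that instance** (Noetherian UFD `R`, `I ⊆ Jac(R)`, `L ≠ 0`): it
yields `R/(L)` torsion with `Fitt₀(R/(L)) = char(R/(L)) = (L)`, in agreement with the
independently proved `charIdeal_quotient_span_singleton`. The instance is non-zero as soon as `L`
is not a unit, so the hypotheses of `isTorsion_and_charIdeal_eq_of_congruences` are NOT vacuous
(contrast the generation-1 link hypotheses of this route). [folklore] -/
theorem congruenceSkeleton_conclusion_quotient [IsNoetherianRing R] [IsDomain R]
    [UniqueFactorizationMonoid R] (I : Ideal R) (hI : I ≤ (⊥ : Ideal R).jacobson) {L : R}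
    (hL : L ≠ 0) :
    Module.IsTorsion R (R ⧸ Ideal.span {L}) ∧
      Module.fittingIdeal R (R ⧸ Ideal.span {L}) 0 = Ideal.span {L} ∧
      charIdeal R (R ⧸ Ideal.span {L}) = Ideal.span {L} :=
  isTorsion_and_charIdeal_eq_of_congruences (fun _ : ℕ => R ⧸ Ideal.span {L}) I hI hL
    (fun _ => L) (fun _ _ => LinearEquiv.refl R _)
    (fun _ _ => fittingIdeal_zero_quotient (Ideal.span {L})) (fun _ _ => rfl)

/-- The instance is non-zero for a non-unit `L`: `R/(L)` is nontrivial. [folklore] -/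
theorem nontrivial_quotient_of_not_isUnit {L : R} (hL : ¬ IsUnit L) :
    Nontrivial (R ⧸ Ideal.span {L}) :=
  Ideal.Quotient.nontrivial_iff.mpr (by rwa [Ne, Ideal.span_singleton_eq_top])

end Summit.BirchSwinnertonDyer.Rank1Residual.X11b.CongruenceLimit

end
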